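import Summits.Schanuel.Schanuel.Theorems.RootDecomp1KDegreeLadder04

/-!
# RootDecomp1KDegreeLadder — lens 1, generation 45 «DEGREE LADDER AT FIXED SKEL-QUALITY (DL) + THIN-FIBRE RESIDUAL» (lane K-R30 (b); CLAIM L2155, ACK/CHECKLIST K-g45 L2159, NODE L2213 / REQUEST L2214, writer re-checks L2219/L2221/L2230, critic VERDICT L2216: CLEARED — THEOREM ×1 for DL `degreeLadder`; EDITION 2/3 docstring-only accepted L2224 / files of record L2228 (K ed. 3 f2af863f…); RULE K-R31; lens-1 tally credits ×11 + THEOREM ×2) — continuation (RootDecomp1KDegreeLadder05): §5b limit corollary + §5c relative degree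

(lens-1 g45 HOME kernel K = HOME/decomp-schanuel-lens-1/g45/DegreeLadder.lean EDITION 3 f2af863f…, 2183 l, imports tree `…RootDecomp1KSkelCell01` (the tree now has `…SkelCell10` with §8's `SkelLiouvilleFix`); P DLprobe.lean f44a49e4… rc 0, C DLctrl.lean 394594cd… rc 1 = exactly the 13 planted errors. Port by census-1 gen 19 as `RootDecomp1KDegreeLadder01`–`08` (+ `09` deferred): 01 = K's module doc + §0 residue (`skelLiouvilleFix_of_skelLiouville`, `SkelLiouvilleFix.liouville` / `.transcendental` declared in the TREE namespace `…RootDecomp1KSkelCell` so dot-notation keeps working) + §1 toolkit `bev`/`xdeg`/`dX`/`specX`; 02 = §2 truncations + §3 calculus (`tangent`, Lipschitz, `coeff_specX_bound`); 03 = §4 engine A (`onCurve_exponent_ineq`, `engine_core`); 04 = §4 engine B (`lowDegree_clause`, `engine_of_clause`, `engine`) + §5 THE DEGREE LADDER `degreeLadder (d) (ρ) (hρ : SkelLiouvilleFix (d + 1) ρ) (P : ℤ[X][X]) (hP : P ≠ 0) (hdeg : P.natDegree ≤ d) : bev P (liouvilleNumber 2) ρ ≠ 0` (descent `no_relation_of_engine`);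 05 = §5b limit corollary (`algebraicIndependent_of_forall_fix`) + §5c relative degree (`relDegree_gt`, `skelFix_two_not_mem_adjoin(_complex)`); 06 = §5d the residual `ThinFibre`/`ThinFibreAt` (+ glue `thinFibre_imp_b`) + §6 the toy fibre decided (`sq_fibre_iff`, `toy_clause`); 07 = §7 tightness at d = 1 (`degreeLadder_tight_one`, `rU_injective`, `not_thinFibre_one`, `not_thinFibre_zero`); 08 = §8a the 2-adic mechanism (`two_adic_split`, `two_adic_quality`, hypothesis-free); 09 (DEFERRED until Literature `…DiophantineApproximation.RidoutIntegers` builds on the check farm, rc 75 today) = §8b `isSquare_mul_psNumer_finite`, `isSquare_seventeen_mul_psNumer_finite`, `thinFibreAt_sqMulP` with `Ridout.padicRoth_int` BY NAME (K carries them under a `(hR : PadicRothInt)` binder whose `def` is NOT landed — verdict condition (c)).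
PORT EDITS: import `…SkelCell10` instead of `…SkelCell01` and DELETE K's verbatim copies of the tree's §8 (`SkelLiouvilleFix`, `skelLiouville_iff_fix`, `SkelLiouvilleFix.mono`, `uStar`, `dU`, `rU`, `dU_cast`, `two_pow_le_four_mul_dU`, `two_mul_dU_lt`, `one_le_dU`, `rU_den`, `rU_cast`, `uStar_sub_rU`, `skelLiouvilleFix_one_uStar`, `not_skelFixOne_algebraicIndependent` — 15 blocks, opened from `…RootDecomp1KSkelCell` by name; verdict condition (a)); the file-wide linter option dropped (b); 58 one-line docstrings added to undocumented helper lemmas; 34 small generic ℓ₂/`psNumer`/`partialSum`/cast lemmas made PRIVATE (dedup-safety against tree twins in TwoBaseCell/CommonRadixCell/SkelCell/RadixCell) with per-part private copies; `ThinFibre`/`ThinFibreAt` docstrings carry the residual-class tag (d); graded statements and proofs otherwise verbatim. `--supports stmt-Schanuel-33364`; no census credit carried; rung 0 — nothing here proves Schanuel, `FiniteOrderLiouvilleSchanuel` (33364), `CoordLiouvilleSchanuel` (31077) or (b) at fixed quality.)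
-/

noncomputable section

open Polynomial LiouvilleNumber
open scoped Nat

namespace Summit.Schanuel.Schanuel.Theorems.RootDecomp1KDegreeLadder

open Summit.Schanuel.Schanuel.Theorems.RootDecomp1KSkelCell
  (exists_le_two_pow_factorial iota iota_spec iota_le_of_le pow_lt_of_lt_iota lt_iota_of_pow_lt iota_mono
   one_le_iota SkelLiouville SkelLiouvilleFix skelLiouville_iff_fix SkelLiouvilleFix.mono uStar dU rU dU_cast
   two_pow_le_four_mul_dU two_mul_dU_lt one_le_dU rU_den rU_cast uStar_sub_rU skelLiouvilleFix_one_uStar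
   not_skelFixOne_algebraicIndependent)
open Summit.Schanuel.Schanuel.Theorems.RootDecomp1KTwoBaseCell (psNumer partialSum_eq_psNumer_div coprime_psNumer
  algebraicIndependent_of_forall_int')
open Summit.Schanuel.Schanuel.Theorems.RootDecomp1KRelLiouvilleCell (partialSum_two_strictMono
  partialSum_two_lt_liouvilleNumber abs_liouvilleNumber_two_sub_partialSum)

/-! ## §5b  The limit corollary: `Skel = ⋂ₘ Skel₍ₘ₎ ⇒ (ℓ₂, ρ)` algebraically independent over `ℚ` -/

section Bridge

/-- `MvPolynomial (Fin 2) ℤ → ℤ[X][Y]`: `X 0 ↦ x` (inner variable), `X 1 ↦ Y` (outer variable). -/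
def toBiv : MvPolynomial (Fin 2) ℤ →+* ℤ[X][X] :=
  MvPolynomial.eval₂Hom (Polynomial.C.comp Polynomial.C) ![Polynomial.C Polynomial.X, Polynomial.X]

/-- its inverse `ℤ[X][Y] → MvPolynomial (Fin 2) ℤ`. -/
def ofBiv : ℤ[X][X] →+* MvPolynomial (Fin 2) ℤ :=
  Polynomial.eval₂RingHom (Polynomial.eval₂RingHom MvPolynomial.C (MvPolynomial.X 0)) (MvPolynomial.X 1)

/-- `ofBiv ∘ toBiv = id` on `MvPolynomial (Fin 2) ℤ`. -/
theorem ofBiv_comp_toBiv : ofBiv.comp toBiv = RingHom.id _ := by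
  refine MvPolynomial.ringHom_ext (fun a => ?_) (fun i => ?_)
  · simp [ofBiv, toBiv]
  · fin_cases i <;> simp [ofBiv, toBiv]

/-- `toBiv` is injective on non-zero polynomials. -/
theorem toBiv_ne_zero {G : MvPolynomial (Fin 2) ℤ} (hG : G ≠ 0) : toBiv G ≠ 0 := by
  intro h
  apply hG
  have h1 := RingHom.congr_fun ofBiv_comp_toBiv G
  rw [RingHom.comp_apply, h, map_zero, RingHom.id_apply] at h1
  exact h1.symm

/-- `bev (toBiv G) x y = G(x, y)`. -/
theorem bev_toBiv (G : MvPolynomial (Fin 2) ℤ) (x y : ℝ) :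
    bev (toBiv G) x y = MvPolynomial.aeval ![x, y] G := by
  have key : (Polynomial.eval₂RingHom (aeval x : ℤ[X] →ₐ[ℤ] ℝ).toRingHom y).comp toBiv =
      (MvPolynomial.aeval ![x, y] : MvPolynomial (Fin 2) ℤ →ₐ[ℤ] ℝ).toRingHom := by
    refine MvPolynomial.ringHom_ext (fun a => ?_) (fun i => ?_)
    · simp [toBiv]
    · fin_cases i <;> simp [toBiv]
  have h := RingHom.congr_fun key G
  simpa [bev, Polynomial.eval_map] using h

/-- real → complex transfer of integer evaluations. -/
private theorem aeval_ofReal (v : Fin 2 → ℝ) (G : MvPolynomial (Fin 2) ℤ) :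
    MvPolynomial.aeval (fun i => ((v i : ℝ) : ℂ)) G = ((MvPolynomial.aeval v G : ℝ) : ℂ) := by
  have h := MvPolynomial.eval₂_comp_left Complex.ofRealHom (algebraMap ℤ ℝ) v G
  rw [MvPolynomial.aeval_def, MvPolynomial.aeval_def,
    RingHom.ext_int (algebraMap ℤ ℂ) (Complex.ofRealHom.comp (algebraMap ℤ ℝ))]
  rw [show (fun i => ((v i : ℝ) : ℂ)) = Complex.ofRealHom ∘ v from by funext i; simp] 
  rw [← h]; simp

/-- NO integer relation `P(x, y) = 0` (`P ∈ ℤ[X][Y] ∖ 0`) ⇒ `(x, y)` algebraically independent over `ℚ`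
(through the tree's `algebraicIndependent_of_forall_int'`). -/
theorem algebraicIndependent_of_no_relation {x y : ℝ}
    (h : ∀ P : ℤ[X][X], P ≠ 0 → bev P x y ≠ 0) :
    AlgebraicIndependent ℚ ![(x : ℂ), (y : ℂ)] := by
  apply algebraicIndependent_of_forall_int'
  intro G hG hzero
  apply h (toBiv G) (toBiv_ne_zero hG)
  rw [bev_toBiv]
  have h1 : (![(x : ℂ), (y : ℂ)] : Fin 2 → ℂ) = fun i => ((![x, y] i : ℝ) : ℂ) := by
    funext i; fin_cases i <;> simp
  rw [h1, aeval_ofReal] at hzero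
  exact_mod_cast hzero

/-- **LIMIT COROLLARY (the g44 pair cell, re-derived through DL).**  `ρ ∈ ⋂ₘ Skel₍ₘ₎ ⇒ (ℓ₂, ρ)` algebraically
independent over `ℚ`. -/
theorem algebraicIndependent_of_forall_fix {ρ : ℝ} (hρ : ∀ m, SkelLiouvilleFix m ρ) :
    AlgebraicIndependent ℚ ![((liouvilleNumber 2 : ℝ) : ℂ), (ρ : ℂ)] :=
  algebraicIndependent_of_no_relation (fun P hP => no_relation_of_forall_fix hρ P hP)

/-- Second, measure-free route to the g44 pair theorem: `ρ ∈ Skel ⇒ (ℓ₂, ρ)` algebraically independent over `ℚ` (×0; PRIVATE at port — the statement coincides with the tree's `RootDecomp1KSkelCell.algebraicIndependent_ell2_of_skelLiouville`, dedup p832967; kept for its different proof). -/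
private theorem algebraicIndependent_of_skelLiouville {ρ : ℝ} (hρ : SkelLiouville ρ) :
    AlgebraicIndependent ℚ ![((liouvilleNumber 2 : ℝ) : ℂ), (ρ : ℂ)] :=
  algebraicIndependent_of_forall_fix (skelLiouvilleFix_of_skelLiouville hρ)

end Bridge

/-! ## §5c  The field reading: relative degree over `ℚ(ℓ₂)` -/

section Field

/-- elements of `ℚ(x) ⊂ ℝ` are quotients `F(x)/G(x)` of INTEGER polynomials with `G(x) ≠ 0`. -/
private theorem exists_int_frac_of_mem_adjoin {x c : ℝ} (hc : c ∈ IntermediateField.adjoin ℚ {x}) :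
    ∃ F G : ℤ[X], aeval x G ≠ 0 ∧ c = aeval x F / aeval x G := by
  rw [IntermediateField.mem_adjoin_simple_iff] at hc
  obtain ⟨f, g, hfg⟩ := hc
  by_cases hg : aeval x g = 0
  · refine ⟨0, 1, by simp, ?_⟩
    rw [hfg, hg, div_zero]; simp
  obtain ⟨bf, hbfM, hbf⟩ := IsLocalization.integerNormalization_spec (nonZeroDivisors ℤ) f
  obtain ⟨bg, hbgM, hbg⟩ := IsLocalization.integerNormalization_spec (nonZeroDivisors ℤ) g
  set F₀ := IsLocalization.integerNormalization (nonZeroDivisors ℤ) f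
  set G₀ := IsLocalization.integerNormalization (nonZeroDivisors ℤ) g
  have hbf0 : ((bf : ℤ) : ℝ) ≠ 0 := by exact_mod_cast nonZeroDivisors.ne_zero hbfM
  have hbg0 : ((bg : ℤ) : ℝ) ≠ 0 := by exact_mod_cast nonZeroDivisors.ne_zero hbgM
  have hF : aeval x F₀ = ((bf : ℤ) : ℝ) * aeval x f := by
    rw [← Polynomial.aeval_map_algebraMap ℚ x F₀, hbf, map_zsmul, zsmul_eq_mul]
  have hG : aeval x G₀ = ((bg : ℤ) : ℝ) * aeval x g := by
    rw [← Polynomial.aeval_map_algebraMap ℚ x G₀, hbg, map_zsmul, zsmul_eq_mul]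
  refine ⟨C bg * F₀, C bf * G₀, ?_, ?_⟩
  · rw [map_mul, aeval_C, hG]; simp only [algebraMap_int_eq, eq_intCast]
    exact mul_ne_zero hbf0 (mul_ne_zero hbg0 hg)
  · rw [map_mul, map_mul, aeval_C, aeval_C, hF, hG]; simp only [algebraMap_int_eq, eq_intCast]
    rw [hfg]; field_simp

/-- **RELATIVE DEGREE (general `d`).**  `ρ ∈ Skel₍d+1₎ ⇒ ρ` is a root of NO non-zero polynomial of degree `≤ d`
with coefficients in the field `ℚ(ℓ₂)`; i.e. `[ℚ(ℓ₂, ρ) : ℚ(ℓ₂)] > d` (or `ρ` transcendental over `ℚ(ℓ₂)`). -/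
theorem relDegree_gt (d : ℕ) {ρ : ℝ} (hρ : SkelLiouvilleFix (d + 1) ρ)
    (p : Polynomial (IntermediateField.adjoin ℚ {liouvilleNumber 2})) (hp : p ≠ 0)
    (hdeg : p.natDegree ≤ d) : aeval ρ p ≠ 0 := by
  classical
  have hc : ∀ j : ℕ, ∃ FG : ℤ[X] × ℤ[X], aeval (liouvilleNumber 2) FG.2 ≠ 0 ∧
      ((p.coeff j : IntermediateField.adjoin ℚ {liouvilleNumber 2}) : ℝ) =
        aeval (liouvilleNumber 2) FG.1 / aeval (liouvilleNumber 2) FG.2 := by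
    intro j
    obtain ⟨F, G, h1, h2⟩ := exists_int_frac_of_mem_adjoin (p.coeff j).2
    exact ⟨(F, G), h1, h2⟩
  choose FG hG hFG using hc
  set n := p.natDegree with hn
  set E : ℕ → ℤ[X] := fun j => ∏ i ∈ (Finset.range (n + 1)).erase j, (FG i).2 with hE
  set D : ℤ[X] := ∏ i ∈ Finset.range (n + 1), (FG i).2 with hD
  set P : ℤ[X][X] := ∑ j ∈ Finset.range (n + 1), monomial j ((FG j).1 * E j) with hP
  have hPcoeff : ∀ j, P.coeff j = if j ∈ Finset.range (n + 1) then (FG j).1 * E j else 0 := by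
    intro j
    rw [hP, finsetSum_coeff]
    simp only [coeff_monomial]
    rw [Finset.sum_ite_eq']
  have hPdeg : P.natDegree ≤ n := by
    rw [hP]
    refine natDegree_sum_le_of_forall_le _ _ fun j hj => (natDegree_monomial_le _).trans ?_
    have := Finset.mem_range.mp hj; omega
  have hPne : P ≠ 0 := by
    intro h0
    have h1 : P.coeff n = (FG n).1 * E n := by
      rw [hPcoeff, if_pos (Finset.mem_range.mpr (Nat.lt_succ_self n))]
    rw [h0, coeff_zero] at h1
    have hFn : (FG n).1 ≠ 0 := by
      intro hz
      have h2 : ((p.coeff n : IntermediateField.adjoin ℚ {liouvilleNumber 2}) : ℝ) = 0 := by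
        rw [hFG n, hz, map_zero, zero_div]
      apply hp
      apply leadingCoeff_eq_zero.mp
      show p.coeff n = 0
      exact_mod_cast h2
    have hEn : E n ≠ 0 :=
      Finset.prod_ne_zero_iff.mpr fun i _ hz => hG i (by rw [hz, map_zero])
    exact (mul_ne_zero hFn hEn) h1.symm
  have hDℓ : aeval (liouvilleNumber 2) D ≠ 0 := by
    rw [hD, map_prod]; exact Finset.prod_ne_zero_iff.mpr fun i _ => hG i
  have hEval : ∀ y : ℝ, bev P (liouvilleNumber 2) y = aeval (liouvilleNumber 2) D * aeval y p := by
    intro y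
    have hpy : aeval y p = ∑ i ∈ Finset.range (n + 1), p.coeff i • y ^ i :=
      Polynomial.aeval_eq_sum_range y
    rw [bev_eq_sum P (lt_of_le_of_lt hPdeg (Nat.lt_succ_self n)), hpy, Finset.mul_sum]
    refine Finset.sum_congr rfl fun j hj => ?_
    rw [hPcoeff, if_pos hj, map_mul, Algebra.smul_def]
    have hDE : aeval (liouvilleNumber 2) D =
        aeval (liouvilleNumber 2) (FG j).2 * aeval (liouvilleNumber 2) (E j) := by
      rw [← map_mul, hD, hE]; congr 1; exact (Finset.mul_prod_erase _ _ hj).symm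
    have hcoe : algebraMap (IntermediateField.adjoin ℚ {liouvilleNumber 2}) ℝ (p.coeff j) =
        ((p.coeff j : IntermediateField.adjoin ℚ {liouvilleNumber 2}) : ℝ) := rfl
    rw [hcoe, hFG j, hDE, div_mul_eq_mul_div, mul_div_assoc', eq_div_iff (hG j)]
    ring
  intro hzero
  have := degreeLadder d ρ hρ P hPne (hPdeg.trans hdeg)
  rw [hEval ρ, hzero, mul_zero] at this
  exact this rfl

/-- **`d = 1`: `Skel₍₂₎ ∋ ρ ⇒ ρ ∉ ℚ(ℓ₂)`** (the corollary asked for in CHECKLIST K-g45 (1)). -/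
theorem skelFix_two_not_mem_adjoin {ρ : ℝ} (hρ : SkelLiouvilleFix 2 ρ) :
    ρ ∉ IntermediateField.adjoin ℚ {liouvilleNumber 2} := by
  intro hmem
  set K := IntermediateField.adjoin ℚ {liouvilleNumber 2}
  have h := relDegree_gt 1 hρ (X - C (⟨ρ, hmem⟩ : K)) (X_sub_C_ne_zero _)
    (by rw [natDegree_X_sub_C])
  apply h
  rw [map_sub, aeval_X, aeval_C]
  exact sub_self ρ

/-- real ↔ complex: membership of `(ρ : ℂ)` in `ℚ⟮(x : ℂ)⟯ ⊆ ℂ` forces `ρ ∈ ℚ⟮x⟯ ⊆ ℝ`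
(`ℚ⟮x⟯.map (ℝ →ₐ[ℚ] ℂ) = ℚ⟮(x : ℂ)⟯`, `IntermediateField.adjoin_map`, and injectivity of `ℝ → ℂ`). -/
private theorem mem_adjoin_real_of_complex {x ρ : ℝ}
    (h : (ρ : ℂ) ∈ IntermediateField.adjoin ℚ ({((x : ℝ) : ℂ)} : Set ℂ)) :
    ρ ∈ IntermediateField.adjoin ℚ ({x} : Set ℝ) := by
  set f : ℝ →ₐ[ℚ] ℂ := Complex.ofRealAm.restrictScalars ℚ with hf
  have hfx : ∀ y : ℝ, f y = (y : ℂ) := fun y => rfl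
  have himg : ({((x : ℝ) : ℂ)} : Set ℂ) = f '' {x} := by
    rw [Set.image_singleton, hfx]
  rw [himg, ← IntermediateField.adjoin_map] at h
  rw [IntermediateField.mem_map] at h
  obtain ⟨y, hy, hyx⟩ := h
  have : y = ρ := by
    have h1 : (y : ℂ) = (ρ : ℂ) := by rw [← hfx]; exact hyx
    exact_mod_cast h1
  rw [← this]; exact hy

/-- **Relative degree ≥ 2 in the printed (complex) shape of CHECKLIST (1):**
`ρ ∈ Skel₍₂₎ ⇒ (ρ : ℂ) ∉ ℚ⟮(ℓ₂ : ℂ)⟯`. -/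
theorem skelFix_two_not_mem_adjoin_complex {ρ : ℝ} (hρ : SkelLiouvilleFix 2 ρ) :
    (ρ : ℂ) ∉ IntermediateField.adjoin ℚ ({((liouvilleNumber 2 : ℝ) : ℂ)} : Set ℂ) :=
  fun h => skelFix_two_not_mem_adjoin hρ (mem_adjoin_real_of_complex h)

end Field

end Summit.Schanuel.Schanuel.Theorems.RootDecomp1KDegreeLadder

end
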